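import Literature.IUT.HodgeArakelov.MonoThetaProjectiveR
import Literature.IUT.HodgeArakelov.Def11OutputTransport

/-!
# [IUTchII] Proposition 1.5 (i): bookkeeping on `Prop15_i` / `IsMonoThetaCompatible`, and the chain-to-`ℕ_{≥1}`
# extension of model isomorphisms (proof-only companion; the "chain rigidity" route)

Proof-only companion (abc-iut cell, D-0067 discharge wave 4, seat abc-iut-w4-d030; DAG node
**IUTchII:Prop1.5(i)**) of abc-iut-L6-t1's frozen statement file `MonoThetaProjective.lean` (p407497) and of its
repair file of record `MonoThetaProjectiveR.lean` (`Prop15_i'`, `IsMonoThetaCompatible`, `ModelFamily.Reductions`).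
NO new definition, NO new named fact; nothing of the two statement files is edited or restated. HISTORY: this is
the text of p411680 (accepted, commit 860586c65863, at the path `MonoThetaProjectiveProofs.lean`), whose
declarations were removed from the tree when abc-iut-w4-d038's p411948 landed on the same path (now the file of
record there: `MonoThetaProjSystem.prop15_i'_of_cor218_iv`, the route of [EtTh] p. 66 (the `R¹ lim`s vanish)
from [EtTh] Cor. 2.18 (iv) read at the models — the route the cell's genuine-model discharge `EtaleLevels.prop15_i'_etaleLevels` uses);
re-landed here at its own path, unchanged.

Source: S. Mochizuki, *Inter-universal Teichmüller theory II*, kurims manuscript (Dec. 2020) of PRIMS **57**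
(2021), Prop. 1.5 (i) p. 29 (of a projective system `… → M^Θ_{M'} → M^Θ_M → …` in which "the index `M` of the
projective system varies multiplicatively among the elements of `ℕ_{≥1}`"): "Such a projective system is uniquely
determined, up to isomorphism, by `X̲̲_k` [cf. Remark 1.5.1 below; the discrete rigidity property of [EtTh],
Corollary 2.19, (ii)]" (claim key `Mochizuki2012`, status DISPUTED, D-0012), and S. Mochizuki, *The étale theta
function …*, Publ. RIMS **45** (2009), Cor. 2.19 (ii) p. 290 (PRIMS PDF p. 64): "Let `E ⊆ ℕ_{≥1}` be a cofinal,
totally ordered subset of `ℕ_{≥1}` [cf. Proposition 2.15] such that `1 ∈ E`. … Then any projective system … is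
isomorphic to the above natural projective system" (emphasis for this file: totally ordered), Def. 2.13 (ii) p. 274 / Cor. 2.18 (iv) p. 287 ("the mod `M` mono-theta environment `𝕄_M` determined by
`𝕄` induces a natural homomorphism `Aut^μ(𝕄) → Aut^μ(𝕄_M)` with normal image", `μ` = `μ_N`-conjugacy classes of
isomorphisms). v2 (doc-only): the v1 header paraphrased this sentence inside quotation marks without the superscript
`μ` (cf. referee lane P DEFECT #180 on the sibling file); repaired by the verbatim sentence; no Lean content changed.

What is PROVED here (pure bookkeeping over the interfaces; no side is taken on [IUTchIII] Cor. 3.12):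
* `prop15_i_refl/symm/trans` — the frozen conclusion `Prop15_i A B` (compatibly isomorphic) is an equivalence
  relation on projective systems over a model family;
* `isMonoThetaCompatible_of_prop15_i` — the repaired hypothesis `IsMonoThetaCompatible R` is invariant under
  `Prop15_i` (a property of the ISOMORPHISM CLASS of the system); `trans_surjective_of_isMonoThetaCompatible`;
* `prop15_i_of_modelIsos`, `isMonoThetaCompatible_of_modelIsos`, `prop15_i'_of_discreteRigidity` — `Prop15_i'`
  from [EtTh] Cor. 2.19 (ii) read OVER `ℕ_{≥1}` (every `R`-compatible system is compatibly isomorphic to the MODEL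
  system `(F.modelEnv M, R.red)`);
* `exists_modelIsos_of_chain`, `prop15_i'_of_chainRigidity` — the chain-to-`ℕ_{≥1}` extension: a compatible family
  of model isomorphisms along ONE cofinal chain (what [EtTh] Cor. 2.19 (ii) provides; tree:
  `ThetaEnvTower.Cor219_ii` / `exists_iso_of_systems`) extends to all of `ℕ_{≥1}` given the reduction of model
  automorphisms ([EtTh] Cor. 2.18 (iv); tree: `ThetaEnvTower.Cor218_iv_reduction`, at the genuine models
  `EtaleLevels.red_descends`). An alternative to the `R¹ lim` route; kept for the record.
Typed ≠ discharged; nothing printed is asserted unconditionally. [cite: MochizukiEtTh2009, Cor 2.19(ii) p.64]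
-/

namespace Literature.IUT.HodgeArakelov

universe u

variable {S : ThetaSetting.{u}} {F : ModelFamily S}

/-! ## `Prop15_i` is an equivalence relation -/

/-- `Prop15_i` is reflexive: the identity isomorphisms form a compatible family ([IUTchII] Prop. 1.5 (i),
"uniquely determined, up to isomorphism"). [cite: Mochizuki2012, Prop 1.5 (i) p.29] -/
theorem prop15_i_refl (A : MonoThetaProjSystem F) : Prop15_i A A :=
  ⟨fun M => MonoThetaEnv.Iso.refl (A.env M), fun _ _ => rfl⟩

/-- `Prop15_i` is symmetric: the inverses of a compatible family of isomorphisms of mono-theta environments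
form a compatible family. [cite: Mochizuki2012, Prop 1.5 (i) p.29] -/
theorem prop15_i_symm {A B : MonoThetaProjSystem F} (h : Prop15_i A B) : Prop15_i B A := by
  obtain ⟨e, he⟩ := h
  refine ⟨fun M => (e M).symm, fun {M M'} hd y => ?_⟩
  change (e M).iso.symm (B.trans hd y) = A.trans hd ((e M').iso.symm y)
  apply (e M).iso.injective
  rw [ContinuousMulEquiv.apply_symm_apply, he hd, ContinuousMulEquiv.apply_symm_apply]

/-- `Prop15_i` is transitive: composites of compatible families are compatible.
[cite: Mochizuki2012, Prop 1.5 (i) p.29] -/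
theorem prop15_i_trans {A B C : MonoThetaProjSystem F} (hAB : Prop15_i A B) (hBC : Prop15_i B C) :
    Prop15_i A C := by
  obtain ⟨e, he⟩ := hAB
  obtain ⟨f, hf⟩ := hBC
  refine ⟨fun M => (e M).trans (f M), fun {M M'} hd x => ?_⟩
  change (f M).iso ((e M).iso (A.trans hd x)) = C.trans hd ((f M').iso ((e M').iso x))
  rw [he hd, hf hd]

namespace MonoThetaProjSystem

/-! ## Consequences of `IsMonoThetaCompatible`: the transitions are surjective -/

/-- In an `R`-compatible projective system every transition `Π_{M^Θ_{M'}} → Π_{M^Θ_M}` is SURJECTIVE (it is,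
up to isomorphisms of mono-theta environments at both ends, the model reduction, which is onto — [EtTh] Def.
2.13 (ii) "`M_{N'}` … induced by `M`"). [cite: Mochizuki2012, Prop 1.5 (i) p.29] -/
theorem trans_surjective_of_isMonoThetaCompatible (R : F.Reductions) (Sys : MonoThetaProjSystem F)
    (hSys : Sys.IsMonoThetaCompatible R) {M M' : ℕ+} (h : (M : ℕ) ∣ (M' : ℕ)) :
    Function.Surjective (Sys.trans h) := by
  obtain ⟨i', i, hii⟩ := hSys M M' h
  intro y
  obtain ⟨v, hv⟩ := R.red_surjective h (i.iso y)
  refine ⟨i'.iso.symm v, i.iso.injective ?_⟩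
  rw [hii, ContinuousMulEquiv.apply_symm_apply, hv]

/-- `IsMonoThetaCompatible R` is invariant under compatible isomorphism of systems (`Prop15_i`): the repaired
hypothesis of Prop. 1.5 (i) is a property of the ISOMORPHISM CLASS of the projective system.
[cite: Mochizuki2012, Prop 1.5 (i) p.29] -/
theorem isMonoThetaCompatible_of_prop15_i (R : F.Reductions) {A B : MonoThetaProjSystem F}
    (hAB : Prop15_i A B) (hA : A.IsMonoThetaCompatible R) : B.IsMonoThetaCompatible R := by
  obtain ⟨e, he⟩ := hAB
  intro M M' h
  obtain ⟨i', i, hii⟩ := hA M M' h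
  refine ⟨(e M').symm.trans i', (e M).symm.trans i, fun y => ?_⟩
  change i.iso ((e M).iso.symm (B.trans h y)) = R.red h (i'.iso ((e M').iso.symm y))
  have hy : B.trans h y = (e M).iso (A.trans h ((e M').iso.symm y)) := by
    rw [he h, ContinuousMulEquiv.apply_symm_apply]
  rw [hy, ContinuousMulEquiv.symm_apply_apply, hii]

/-! ## Compatible families of isomorphisms with the MODEL system `(F.modelEnv M, R.red)` -/

/-- A system admitting a compatible family of isomorphisms of mono-theta environments with the model system
`(F.modelEnv M, R.red_{M',M})` is `R`-compatible (each transition IS the model reduction up to those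
isomorphisms). [cite: Mochizuki2012, Prop 1.5 (i) p.29] -/
theorem isMonoThetaCompatible_of_modelIsos (R : F.Reductions) (Sys : MonoThetaProjSystem F)
    (a : ∀ M : ℕ+, MonoThetaEnv.Iso (Sys.env M) (F.modelEnv M))
    (ha : ∀ {M M' : ℕ+} (h : (M : ℕ) ∣ (M' : ℕ)) (x : (Sys.env M').Pi),
      (a M).iso (Sys.trans h x) = R.red h ((a M').iso x)) :
    Sys.IsMonoThetaCompatible R :=
  fun M M' h => ⟨a M', a M, fun x => ha h x⟩

end MonoThetaProjSystem

/-- Two systems each admitting a compatible family of isomorphisms with the model system are compatibly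
isomorphic to each other (`Prop15_i`): compose one family with the inverse of the other. This is how [EtTh]
Cor. 2.19 (ii) ("any projective system … is isomorphic to the above natural projective system") yields
[IUTchII] Prop. 1.5 (i)
("uniquely determined, up to isomorphism"). [cite: Mochizuki2012, Prop 1.5 (i) p.29] -/
theorem prop15_i_of_modelIsos (R : F.Reductions) {A B : MonoThetaProjSystem F}
    (hA : ∃ a : ∀ M : ℕ+, MonoThetaEnv.Iso (A.env M) (F.modelEnv M),
      ∀ {M M' : ℕ+} (h : (M : ℕ) ∣ (M' : ℕ)) (x : (A.env M').Pi),
        (a M).iso (A.trans h x) = R.red h ((a M').iso x))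
    (hB : ∃ b : ∀ M : ℕ+, MonoThetaEnv.Iso (B.env M) (F.modelEnv M),
      ∀ {M M' : ℕ+} (h : (M : ℕ) ∣ (M' : ℕ)) (y : (B.env M').Pi),
        (b M).iso (B.trans h y) = R.red h ((b M').iso y)) :
    Prop15_i A B := by
  obtain ⟨a, ha⟩ := hA
  obtain ⟨b, hb⟩ := hB
  refine ⟨fun M => (a M).trans (b M).symm, fun {M M'} h x => ?_⟩
  change (b M).iso.symm ((a M).iso (A.trans h x)) = B.trans h ((b M').iso.symm ((a M').iso x))
  apply (b M).iso.injective
  rw [ContinuousMulEquiv.apply_symm_apply, ha h, hb h, ContinuousMulEquiv.apply_symm_apply]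

/-- **`Prop15_i'` ⟸ discrete rigidity over `ℕ_{≥1}`.** If every `R`-compatible projective system of mono-theta
environments over the model family admits a compatible family of isomorphisms with the model system
`(F.modelEnv M, R.red)` — [EtTh] Cor. 2.19 (ii) "(Discrete Rigidity) … any projective system … is isomorphic
to the above natural projective system", read over the index set `ℕ_{≥1}` of [IUTchII] Prop. 1.5 — then the
repaired [IUTchII] Prop. 1.5 (i) `Prop15_i' R A B` holds for all `A`, `B`. (Hypothesis spelled inline in the
language of `ModelFamily.Reductions`; its transport from the [EtTh] tower is the merge TODO-merge:abc-iut-L2-t2.)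
[cite: Mochizuki2012, Prop 1.5 (i) p.29] -/
theorem prop15_i'_of_discreteRigidity (R : F.Reductions)
    (hDR : ∀ Sys : MonoThetaProjSystem F, Sys.IsMonoThetaCompatible R →
      ∃ a : ∀ M : ℕ+, MonoThetaEnv.Iso (Sys.env M) (F.modelEnv M),
        ∀ {M M' : ℕ+} (h : (M : ℕ) ∣ (M' : ℕ)) (x : (Sys.env M').Pi),
          (a M).iso (Sys.trans h x) = R.red h ((a M').iso x))
    (A B : MonoThetaProjSystem F) : Prop15_i' R A B :=
  fun hA hB => prop15_i_of_modelIsos R (hDR A hA) (hDR B hB)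

/-! ## From a cofinal CHAIN (the index set of [EtTh] Cor. 2.19 (ii)) to all of `ℕ_{≥1}` (the index set of
[IUTchII] Prop. 1.5) -/

namespace MonoThetaProjSystem

/-- Along a chain `c₀ ∣ c₁ ∣ c₂ ∣ …`, `c_i ∣ c_j` for `i ≤ j` (bookkeeping). [cite: Mochizuki2012, Prop 1.5 (i) p.29] -/
theorem chain_dvd (c : ℕ → ℕ+) (hc : ∀ k, (c k : ℕ) ∣ (c (k + 1) : ℕ)) {i j : ℕ} (hij : i ≤ j) :
    (c i : ℕ) ∣ (c j : ℕ) := by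
  induction hij with
  | refl => exact dvd_rfl
  | step _ ih => exact ih.trans (hc _)

/-- A family of model isomorphisms compatible along the consecutive steps `c_k ∣ c_{k+1}` of a chain is compatible
along every `c_i ∣ c_j`, `i ≤ j` (functoriality of the transitions and of the model reductions).
[cite: Mochizuki2012, Prop 1.5 (i) p.29] -/
theorem chain_compat (R : F.Reductions) (Sys : MonoThetaProjSystem F)
    (c : ℕ → ℕ+) (hc : ∀ k, (c k : ℕ) ∣ (c (k + 1) : ℕ))
    (a : ∀ k, MonoThetaEnv.Iso (Sys.env (c k)) (F.modelEnv (c k)))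
    (ha : ∀ k (x : (Sys.env (c (k + 1))).Pi),
      (a k).iso (Sys.trans (hc k) x) = R.red (hc k) ((a (k + 1)).iso x))
    {i j : ℕ} (hij : i ≤ j) (hdiv : (c i : ℕ) ∣ (c j : ℕ)) (x : (Sys.env (c j)).Pi) :
    (a i).iso (Sys.trans hdiv x) = R.red hdiv ((a j).iso x) := by
  induction hij with
  | refl => rw [Sys.trans_refl, R.red_refl]
  | @step m him ih =>
    have h1 : Sys.trans hdiv x = Sys.trans (chain_dvd c hc him) (Sys.trans (hc m) x) :=
      (Sys.trans_comp (chain_dvd c hc him) (hc m) x).symm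
    have h2 : R.red hdiv ((a (m + 1)).iso x) =
        R.red (chain_dvd c hc him) (R.red (hc m) ((a (m + 1)).iso x)) :=
      (R.red_comp (chain_dvd c hc him) (hc m) ((a (m + 1)).iso x)).symm
    rw [h1, ih (chain_dvd c hc him), ha m x, h2]

/-- **Extension from a cofinal chain to `ℕ_{≥1}`.** Let `A` be an `R`-compatible projective system ([IUTchII] Prop.
1.5, indexed by ALL `M ∈ ℕ_{≥1}`) and let `a_k : A_{c_k} ⥲ (model at c_k)` be a family of isomorphisms of mono-theta
environments compatible with the transitions/reductions along a cofinal chain `c₀ ∣ c₁ ∣ …` (what [EtTh] Cor. 2.19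
(ii) provides, its `E` being a cofinal TOTALLY ORDERED subset). Assume the REDUCTION of automorphisms ([EtTh] Cor.
2.18 (iv) / Def. 2.13 (ii): every automorphism of the model mono-theta environment at level `M'` induces one at
level `M ∣ M'` along `red_{M',M}`; tree: `ThetaEnvTower.Cor218_iv_reduction`). Then there is a family
`a'_M : A_M ⥲ (model at M)` for EVERY `M ∈ ℕ_{≥1}`, compatible with ALL transitions `M ∣ M'`. Construction:
`a'_M :=` (descent of `a_{c_k} ∘ i'⁻¹`) `∘ i` for `M ∣ c_k` and a compatibility pair `(i', i)`; compatibility for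
`M ∣ M'` is checked on a common chain level `c_K` using the surjectivity of `A_{c_K} → A_{M'}`.
[cite: Mochizuki2012, Prop 1.5 (i) p.29] -/
theorem exists_modelIsos_of_chain (R : F.Reductions) (Sys : MonoThetaProjSystem F)
    (hdesc : ∀ {M M' : ℕ+} (h : (M : ℕ) ∣ (M' : ℕ))
      (ψ' : MonoThetaEnv.Iso (F.modelEnv M') (F.modelEnv M')),
      ∃ ψ : MonoThetaEnv.Iso (F.modelEnv M) (F.modelEnv M),
        ∀ x : (F.modelEnv M').Pi, ψ.iso (R.red h x) = R.red h (ψ'.iso x))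
    (hSys : Sys.IsMonoThetaCompatible R)
    (c : ℕ → ℕ+) (hc : ∀ k, (c k : ℕ) ∣ (c (k + 1) : ℕ)) (hcof : ∀ M : ℕ+, ∃ k, (M : ℕ) ∣ (c k : ℕ))
    (a : ∀ k, MonoThetaEnv.Iso (Sys.env (c k)) (F.modelEnv (c k)))
    (ha : ∀ k (x : (Sys.env (c (k + 1))).Pi),
      (a k).iso (Sys.trans (hc k) x) = R.red (hc k) ((a (k + 1)).iso x)) :
    ∃ a' : ∀ M : ℕ+, MonoThetaEnv.Iso (Sys.env M) (F.modelEnv M),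
      ∀ {M M' : ℕ+} (h : (M : ℕ) ∣ (M' : ℕ)) (x : (Sys.env M').Pi),
        (a' M).iso (Sys.trans h x) = R.red h ((a' M').iso x) := by
  classical
  -- the chosen chain level `k(M)` above `M`, and `M ∣ c_{k(M)}`
  let k : ℕ+ → ℕ := fun M => Classical.choose (hcof M)
  have hk : ∀ M : ℕ+, (M : ℕ) ∣ (c (k M) : ℕ) := fun M => Classical.choose_spec (hcof M)
  -- Step 1: descend `a_{k(M)}` to level `M`
  have key : ∀ M : ℕ+, ∃ aM : MonoThetaEnv.Iso (Sys.env M) (F.modelEnv M),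
      ∀ x : (Sys.env (c (k M))).Pi, aM.iso (Sys.trans (hk M) x) = R.red (hk M) ((a (k M)).iso x) := by
    intro M
    obtain ⟨i', i, hii⟩ := hSys M (c (k M)) (hk M)
    obtain ⟨ψ, hψ⟩ := hdesc (hk M) (i'.symm.trans (a (k M)))
    refine ⟨i.trans ψ, fun x => ?_⟩
    change ψ.iso (i.iso (Sys.trans (hk M) x)) = R.red (hk M) ((a (k M)).iso x)
    rw [hii, hψ]
    change R.red (hk M) ((a (k M)).iso (i'.iso.symm (i'.iso x))) = R.red (hk M) ((a (k M)).iso x)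
    rw [ContinuousMulEquiv.symm_apply_apply]
  choose a' ha' using key
  refine ⟨a', fun {M M'} h x' => ?_⟩
  -- Step 2: compatibility of `a'_M` with every chain level `c_K`, `K ≥ k(M)`
  have claim : ∀ (M : ℕ+) (K : ℕ) (hK : k M ≤ K) (hMK : (M : ℕ) ∣ (c K : ℕ)) (z : (Sys.env (c K)).Pi),
      (a' M).iso (Sys.trans hMK z) = R.red hMK ((a K).iso z) := by
    intro M K hK hMK z
    have h1 : Sys.trans hMK z = Sys.trans (hk M) (Sys.trans (chain_dvd c hc hK) z) :=
      (Sys.trans_comp (hk M) (chain_dvd c hc hK) z).symm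
    have h2 : R.red hMK ((a K).iso z) = R.red (hk M) (R.red (chain_dvd c hc hK) ((a K).iso z)) :=
      (R.red_comp (hk M) (chain_dvd c hc hK) ((a K).iso z)).symm
    rw [h1, ha' M, chain_compat R Sys c hc a ha hK (chain_dvd c hc hK) z, h2]
  -- Step 3: compare `M ∣ M'` on the common chain level `c_K`, `K := max (k M) (k M')`
  let K : ℕ := max (k M) (k M')
  have hM'K : (M' : ℕ) ∣ (c K : ℕ) := (hk M').trans (chain_dvd c hc (le_max_right _ _))
  have hMK : (M : ℕ) ∣ (c K : ℕ) := h.trans hM'K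
  obtain ⟨z, rfl⟩ := trans_surjective_of_isMonoThetaCompatible R Sys hSys hM'K x'
  have h3 : Sys.trans h (Sys.trans hM'K z) = Sys.trans hMK z := Sys.trans_comp h hM'K z
  have h4 : R.red h (R.red hM'K ((a K).iso z)) = R.red hMK ((a K).iso z) := R.red_comp h hM'K ((a K).iso z)
  rw [h3, claim M K (le_max_left _ _) hMK z, claim M' K (le_max_right _ _) hM'K z, h4]

end MonoThetaProjSystem

/-- **[IUTchII] Prop. 1.5 (i) (repaired typing `Prop15_i'`) from its two [EtTh] inputs, in the language of this
interface.** Over a model family `F` with model reductions `R`, suppose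
(a) (discrete rigidity over ONE cofinal chain `c₀ ∣ c₁ ∣ …` — [EtTh] Cor. 2.19 (ii), whose index set `E` is a
cofinal totally ordered subset of `ℕ_{≥1}`; tree `ThetaEnvTower.Cor219_ii` / `exists_iso_of_systems`) every
`R`-compatible system admits, along the chain, a family of isomorphisms with the models compatible with the
consecutive transitions/reductions, and
(b) (reduction of automorphisms — [EtTh] Cor. 2.18 (iv) / Def. 2.13 (ii); tree `ThetaEnvTower.Cor218_iv_reduction`)
every automorphism of the model mono-theta environment at level `M'` induces one at each level `M ∣ M'`.
Then `Prop15_i' R A B` for all systems `A`, `B` indexed by `ℕ_{≥1}` ([IUTchII] Prop. 1.5 (i): "uniquely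
determined, up to isomorphism"). [cite: Mochizuki2012, Prop 1.5 (i) p.29] -/
theorem prop15_i'_of_chainRigidity (R : F.Reductions)
    (c : ℕ → ℕ+) (hc : ∀ k, (c k : ℕ) ∣ (c (k + 1) : ℕ)) (hcof : ∀ M : ℕ+, ∃ k, (M : ℕ) ∣ (c k : ℕ))
    (hchain : ∀ Sys : MonoThetaProjSystem F, Sys.IsMonoThetaCompatible R →
      ∃ a : ∀ k, MonoThetaEnv.Iso (Sys.env (c k)) (F.modelEnv (c k)),
        ∀ k (x : (Sys.env (c (k + 1))).Pi),
          (a k).iso (Sys.trans (hc k) x) = R.red (hc k) ((a (k + 1)).iso x))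
    (hdesc : ∀ {M M' : ℕ+} (h : (M : ℕ) ∣ (M' : ℕ))
      (ψ' : MonoThetaEnv.Iso (F.modelEnv M') (F.modelEnv M')),
      ∃ ψ : MonoThetaEnv.Iso (F.modelEnv M) (F.modelEnv M),
        ∀ x : (F.modelEnv M').Pi, ψ.iso (R.red h x) = R.red h (ψ'.iso x))
    (A B : MonoThetaProjSystem F) : Prop15_i' R A B := by
  refine prop15_i'_of_discreteRigidity R (fun Sys hSys => ?_) A B
  obtain ⟨a, ha⟩ := hchain Sys hSys
  exact MonoThetaProjSystem.exists_modelIsos_of_chain R Sys hdesc hSys c hc hcof a ha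

end Literature.IUT.HodgeArakelov
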